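import Mathlib.Topology.Maps.Proper.Basic
import Mathlib.Topology.Algebra.Group.Basic
import Mathlib.Algebra.Group.Subgroup.Lattice
import HarnessLib

/-!
# The subgroup generated by a proper image and a compact image is closed

Topic `Topology/Algebra`; namespace `Literature.Topology.Algebra.MonoidHom`. Let `C` be a
commutative topological group, `f : A →* C` a continuous homomorphism which is a PROPER map and
`g : N →* C` a continuous homomorphism from a COMPACT group. Then

* `isProperMap_coprod` — `(a, n) ↦ f a · g n : A × N → C` (`MonoidHom.coprod`) is a proper map
  (shear `(c, n) ↦ (c · g n, n)` and `Prod.fst` proper over a compact factor);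
* `isClosed_range_sup_range` — **`B := f.range ⊔ g.range` is closed in `C`**;
* `isProperMap_toSupRange`, `isQuotientMap_toSupRange` — `A × N → B` is proper, hence a quotient
  map, so (`continuous_on_sup_range_iff`) a map out of `B` (subspace topology) is continuous iff
  its pull-back to `A × N` is; in particular (`continuous_char_sup_range_iff`) a homomorphism
  `χ : B →* M` into a topological monoid is continuous iff `a ↦ χ (f a)` and `n ↦ χ (g n)` are.

(The textbook instance: for a CM extension `L/L₀` the subgroup
`B = (𝔸_{L₀}ˣ Lˣ/Lˣ) · (L_∞ˣ Lˣ/Lˣ)` of the idele class group `C_L` is closed, `C_{L₀} → C_L`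
being proper and `L_∞ˣ/L_{0,∞}ˣ` compact; a character of `B` glued from continuous data on the
two factors is then continuous.) Elementary point-set topology (Bourbaki, *General Topology*,
Ch. I §10, proper maps; Ch. III §4); everything is proved (Mathlib only).

## Provenance

Reproduced for the tree under the LEAN-IN-TREE rule (2026-08-18) from the pub-hodgecm cell's
package file `HodgeCM/PerL34/ProperImage.lean` (DAG-node prover #10 lineage, seat pv10, gate
run 21; 157 lines), verbatim up to the namespace (root `MonoidHom` ↦
`Literature.Topology.Algebra.MonoidHom`) and the added docstrings / tags.
-/

open _root_.Topology Filter Set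

namespace Literature.Topology.Algebra

namespace MonoidHom

variable {A N C : Type*} [Group A] [Group N] [CommGroup C] (f : A →* C) (g : N →* C)

/-! ## §1  Algebra: the range of `f.coprod g` is `f.range ⊔ g.range` -/

/-- `f.coprod g = (mul ∘ (id × g)) ∘ (f × id)`. [folklore] -/
theorem coprod_eq_comp :
    ⇑(f.coprod g) = (fun p : C × N => p.1 * g p.2) ∘ Prod.map f _root_.id := by
  ext p; rfl

/-- The range of `f.coprod g : A × N →* C` is `f.range ⊔ g.range` (`C` commutative). [folklore] -/
theorem range_coprod_eq_sup : (f.coprod g).range = f.range ⊔ g.range := by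
  ext c
  constructor
  · rintro ⟨p, rfl⟩
    rw [_root_.MonoidHom.coprod_apply]
    exact mul_mem (Subgroup.mem_sup_left ⟨p.1, rfl⟩) (Subgroup.mem_sup_right ⟨p.2, rfl⟩)
  · intro hc
    obtain ⟨y, ⟨a, rfl⟩, z, ⟨n, rfl⟩, rfl⟩ := Subgroup.mem_sup.mp hc
    exact ⟨(a, n), rfl⟩

/-- Set-level form of `range_coprod_eq_sup`. [folklore] -/
theorem coe_range_coprod_eq :
    Set.range (f.coprod g) = ((f.range ⊔ g.range : Subgroup C) : Set C) := by
  rw [← range_coprod_eq_sup]; rfl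

/-- The map `A × N → B = f.range ⊔ g.range`, `(a, n) ↦ f a · g n`. [folklore] -/
def toSupRange : A × N → (f.range ⊔ g.range : Subgroup C) :=
  fun p => ⟨f p.1 * g p.2,
    mul_mem (Subgroup.mem_sup_left ⟨p.1, rfl⟩) (Subgroup.mem_sup_right ⟨p.2, rfl⟩)⟩

/-- `toSupRange f g (a, n) = f a · g n` in `C`. [folklore] -/
@[simp] theorem coe_toSupRange (p : A × N) : (toSupRange f g p : C) = f p.1 * g p.2 := rfl

/-- `toSupRange f g` is surjective. [folklore] -/
theorem toSupRange_surjective : Function.Surjective (toSupRange f g) := by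
  rintro ⟨c, hc⟩
  obtain ⟨y, ⟨a, rfl⟩, z, ⟨n, rfl⟩, rfl⟩ := Subgroup.mem_sup.mp hc
  exact ⟨(a, n), rfl⟩

/-- `toSupRange f g` followed by the inclusion is `f.coprod g`. [folklore] -/
theorem val_comp_toSupRange : Subtype.val ∘ toSupRange f g = ⇑(f.coprod g) := by
  ext p; rfl

/-! ## §2  Topology -/

variable [TopologicalSpace A] [TopologicalSpace N] [TopologicalSpace C] [IsTopologicalGroup C]

/-- The shear `(c, n) ↦ (c · g n, n)` as a homeomorphism of `C × N`. [folklore] -/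
def shearHomeomorph (hg : Continuous g) : C × N ≃ₜ C × N where
  toFun p := (p.1 * g p.2, p.2)
  invFun p := (p.1 * (g p.2)⁻¹, p.2)
  left_inv p := by simp
  right_inv p := by simp
  continuous_toFun := by fun_prop
  continuous_invFun := by fun_prop

/-- `(a, n) ↦ f a · g n` is a proper map when `f` is proper and `N` is compact. [folklore] -/
theorem isProperMap_coprod [CompactSpace N] (hf : IsProperMap f) (hg : Continuous g) :
    IsProperMap (f.coprod g) := by
  have h1 : IsProperMap (Prod.map f (_root_.id : N → N)) := hf.prodMap isProperMap_id
  have h2 : IsProperMap (fun p : C × N => p.1 * g p.2) := by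
    have : (fun p : C × N => p.1 * g p.2) = Prod.fst ∘ shearHomeomorph g hg := rfl
    rw [this]
    exact isProperMap_fst_of_compactSpace.comp (shearHomeomorph g hg).isProperMap
  rw [coprod_eq_comp]
  exact h2.comp h1

/-- **The subgroup generated by a proper image and a compact image is closed**: if `f : A →* C`
is a proper map and `g : N →* C` is continuous with `N` compact, then `f.range ⊔ g.range` is
closed in `C`. [folklore] -/
theorem isClosed_range_sup_range [CompactSpace N] (hf : IsProperMap f) (hg : Continuous g) :
    IsClosed ((f.range ⊔ g.range : Subgroup C) : Set C) := by
  rw [← coe_range_coprod_eq]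
  exact (isProperMap_coprod f g hf hg).isClosed_range

/-- `toSupRange f g` is continuous. [folklore] -/
theorem continuous_toSupRange (hf : Continuous f) (hg : Continuous g) :
    Continuous (toSupRange f g) := by
  apply Continuous.subtype_mk
  fun_prop

/-- `A × N → f.range ⊔ g.range` is proper (so closed and a quotient map) when `f` is proper and
`N` compact. [folklore] -/
theorem isProperMap_toSupRange [CompactSpace N] (hf : IsProperMap f) (hg : Continuous g) :
    IsProperMap (toSupRange f g) := by
  refine isProperMap_of_comp_of_inj (continuous_toSupRange f g hf.continuous hg)
    continuous_subtype_val ?_ Subtype.val_injective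
  rw [val_comp_toSupRange]
  exact isProperMap_coprod f g hf hg

/-- **The topology of `f.range ⊔ g.range` is the quotient topology from `A × N`** (`f` proper,
`N` compact). [folklore] -/
theorem isQuotientMap_toSupRange [CompactSpace N] (hf : IsProperMap f) (hg : Continuous g) :
    IsQuotientMap (toSupRange f g) :=
  (isProperMap_toSupRange f g hf hg).isClosedMap.isQuotientMap
    (continuous_toSupRange f g hf.continuous hg) (toSupRange_surjective f g)

/-- A map out of `f.range ⊔ g.range` (subspace topology of `C`) is continuous iff its pull-back
to `A × N` is (`f` proper, `N` compact). [folklore] -/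
theorem continuous_on_sup_range_iff [CompactSpace N] (hf : IsProperMap f) (hg : Continuous g)
    {Z : Type*} [TopologicalSpace Z] (φ : (f.range ⊔ g.range : Subgroup C) → Z) :
    Continuous φ ↔ Continuous (φ ∘ toSupRange f g) :=
  (isQuotientMap_toSupRange f g hf hg).continuous_iff

/-- **Gluing continuity.** A homomorphism of `f.range ⊔ g.range` into a topological monoid is
continuous iff its pull-backs along `f` and `g` are (`f` proper, `N` compact). [folklore] -/
theorem continuous_char_sup_range_iff [CompactSpace N] (hf : IsProperMap f) (hg : Continuous g)
    {M : Type*} [Monoid M] [TopologicalSpace M] [ContinuousMul M]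
    (χ : (f.range ⊔ g.range : Subgroup C) →* M) :
    Continuous χ ↔
      Continuous (fun a : A => χ ⟨f a, Subgroup.mem_sup_left ⟨a, rfl⟩⟩) ∧
      Continuous (fun n : N => χ ⟨g n, Subgroup.mem_sup_right ⟨n, rfl⟩⟩) := by
  constructor
  · intro hχ
    constructor
    · exact hχ.comp (Continuous.subtype_mk (hf.continuous.comp continuous_id) _)
    · exact hχ.comp (Continuous.subtype_mk (hg.comp continuous_id) _)
  · rintro ⟨h1, h2⟩
    rw [continuous_on_sup_range_iff f g hf hg]
    have : χ ∘ toSupRange f g = fun p : A × N =>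
        χ ⟨f p.1, Subgroup.mem_sup_left ⟨p.1, rfl⟩⟩ *
          χ ⟨g p.2, Subgroup.mem_sup_right ⟨p.2, rfl⟩⟩ := by
      ext p
      rw [← map_mul]
      rfl
    rw [this]
    exact (h1.comp continuous_fst).mul (h2.comp continuous_snd)

end MonoidHom

end Literature.Topology.Algebra
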